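import Summits.QuantumFields.YangMills.Theorems.BalabanLadderIRTwistedSlabPinnedOrbitConstants
import HarnessLib

/-!
# Product Frobenius reference frames for THE NUMBER: the Frobenius–Lebesgue measure of `𝔤^B` as the push-forward of a Euclidean model,
# its product structure, and the window constants `σ₀(𝔤^B; λ_B) = σ₁^{|B|}` (lit-4 L26)

HELPER toward stub **T1** `TwistedSlabAnchor` (LINE `twisted-slab-continuity`, crux `IRcof` stmt-QuantumFields-26930, census row 43;
LEAD prover ym-ir-line-tsc-p1 g4; `--supports` the crux, `--as helper`).  Sequel of K28 `…FaddeevPopovJacobian` (`suPiWindowConst`, `ePairing`,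
`sPairing`) and K29 `…PinnedOrbitConstants` (`suFieldsLie`); lit-4 L22 `exists_linearEquiv_euclideanSpace_inner_eq` and L26
`windowConst_pi_toReal` BY NAME; Mathlib `Pi.orthonormalBasis`, `OrthonormalBasis.addHaar_eq_volume`, `Basis.addHaar_eq_iff`, `measurePreserving_pi`.
Norm scope `Matrix.Norms.L2Operator`.
* §0 ★ `volume_eq_map_toLp_pi` — the Lebesgue measure of the `L²`-product `PiLp 2 (B → E)` of copies of a Euclidean space IS the product measure
  (Mathlib's `PiLp.volume_preserving_toLp` generalised from `E = ℝ` to finite-dimensional `E`; proof: the parallelepiped of `Pi.orthonormalBasis` is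
  the product of parallelepipeds).
* §1 `re_trace_conjTranspose_mul_self_pos'`, ★ `exists_suFrame` — a Frobenius-isometric Euclidean frame `ι₁ : ℝ^d ≃L 𝔰𝔲(N)` (`⟪u, u'⟫ = Re tr((ι₁u)ᴴ ι₁u')`, L22).
* §2 `piFrame ι₁ B : PiLp 2 (B → ℝ^d) ≃L 𝔤^B` (componentwise `ι₁`, then `lieEquivPi⁻¹`), `coe_piFrame_apply`, ★ `inner_eq_ePairing_piFrame` (Frobenius-
  isometric), ★★ `volume_map_piFrame : vol ∘ piFrame⁻¹ = (⊗_B (vol ∘ ι₁⁻¹)) ∘ lieEquivPi` (§0 + `measurePreserving_pi`) — exactly L26's `λ_B`.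
* §3 `suSiteWindowConst η` (B89's one-site window constant `σ₁ = μ₁(V_s) ∕ ν_s(η)(V_s)` of `SU(N)`, real), `suSiteWindowConst_map_pos`,
  ★★ `suPiWindowConst_piFrame : σ₀(SU(N)^B; vol ∘ piFrame⁻¹; ⊗ Haar prob) = σ₁^{|B|}` (L26 `windowConst_pi_toReal`);
  `sitesFrame ι₁ : PiLp 2 (sites → ℝ^d) ≃L suFields` (`= suFieldsLie⁻¹ ∘ piFrame`), ★ `inner_eq_sPairing_sitesFrame` (Frobenius-isometric).
NOT here (honest scope): the assembly of THE NUMBER (K30b); anything uniform in `β` (M3) or `L, t` (M4); T1-box 0∕1, T1 proper 0∕1.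

HONEST FRAMING: measure-theoretic bookkeeping at one box; nothing here bears on `IRcof`, `IR`, or the Yang–Mills mass gap (Clay: NOT proved); R4 =
`BalabanLadder.UV` only.  References: S. Helgason (2000) Ch. I §1 Thm 1.14 (13) p. 96; T. Bałaban, CMP 102 (1985) (18) p. 260 (`σ₀^{|Ω₁|}`);
R. A. Horn, C. R. Johnson (2013) Cor. 7.2.8.
-/

set_option autoImplicit false

noncomputable section

open scoped Matrix Matrix.Norms.L2Operator InnerProductSpace ENNReal
open MeasureTheory Module Set WithLp
open Literature.MathematicalPhysics.QuantumFieldTheory Literature.MathematicalPhysics.QuantumLattice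
open Literature.Analysis.InnerProduct
open Literature.MathematicalPhysics.QuantumFieldTheory.Balaban1983to89
open Literature.MathematicalPhysics.QuantumFieldTheory.Balaban1983to89.HaarExponentialChart
open Literature.MathematicalPhysics.QuantumFieldTheory.Balaban1983to89.LogChartProduct
open Literature.MathematicalPhysics.QuantumFieldTheory.Balaban1983to89.HaarWindowConstLimit

namespace Summit.QuantumFields.YangMills.Cruxes.IRcof.TwistedSlab

/-! ## §0 The Lebesgue measure of `PiLp 2 (B → E)` is the product measure -/

section PiVolume

variable (B : Type*) [Fintype B] (E : Type*) [NormedAddCommGroup E] [InnerProductSpace ℝ E] [FiniteDimensional ℝ E]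
  [MeasurableSpace E] [BorelSpace E]

/-- ★ **`vol_{PiLp 2 (B → E)} = (⊗_B vol_E) ∘ toLp⁻¹`** for a finite-dimensional real inner-product space `E`: the parallelepiped of the orthonormal
basis `Pi.orthonormalBasis` is `toLp` of the product of the factors' parallelepipeds, both of measure `1`. (Mathlib's `PiLp.volume_preserving_toLp`
is the case `E = ℝ`.) [folklore; Helgason2000 Ch. I §1 (13) («dX the Euclidean measure»)] -/
theorem volume_eq_map_toLp_pi :
    (volume : Measure (PiLp 2 (fun _ : B => E))) = (Measure.pi fun _ : B => (volume : Measure E)).map (toLp 2) := by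
  classical
  set bE := stdOrthonormalBasis ℝ E with hbE
  set bPi : OrthonormalBasis ((_ : B) × Fin (finrank ℝ E)) ℝ (PiLp 2 (fun _ : B => E)) := Pi.orthonormalBasis fun _ : B => bE with hbPi
  have hmeas : Measurable (toLp 2 : (B → E) → PiLp 2 (fun _ : B => E)) :=
    (PiLp.continuousLinearEquiv 2 ℝ (fun _ : B => E)).symm.continuous.measurable
  haveI : ((Measure.pi fun _ : B => (volume : Measure E)).map (toLp 2 : (B → E) → PiLp 2 (fun _ : B => E))).IsAddHaarMeasure := by
    have h := (PiLp.continuousLinearEquiv 2 ℝ (fun _ : B => E)).symm.isAddHaarMeasure_map (Measure.pi fun _ : B => (volume : Measure E))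
    rwa [PiLp.coe_symm_continuousLinearEquiv] at h
  have hPE : parallelepiped (⇑bE) = {y : E | ∀ j, bE.repr y j ∈ Icc (0 : ℝ) 1} := by
    rw [← OrthonormalBasis.coe_toBasis, parallelepiped_basis_eq]
    simp only [OrthonormalBasis.coe_toBasis_repr_apply]
  have hPPi : parallelepiped (⇑bPi) = {x : PiLp 2 (fun _ : B => E) | ∀ s, bPi.repr x s ∈ Icc (0 : ℝ) 1} := by
    rw [← OrthonormalBasis.coe_toBasis, parallelepiped_basis_eq]
    simp only [OrthonormalBasis.coe_toBasis_repr_apply]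
  have hS : MeasurableSet (parallelepiped (⇑bPi)) := by
    rw [← OrthonormalBasis.coe_toBasis, ← Basis.coe_parallelepiped]
    exact bPi.toBasis.parallelepiped.isCompact.isClosed.measurableSet
  have hset : (toLp 2 : (B → E) → PiLp 2 (fun _ : B => E)) ⁻¹' parallelepiped (⇑bPi) = Set.pi univ fun _ : B => parallelepiped (⇑bE) := by
    ext f
    rw [mem_preimage, hPPi, hPE, mem_setOf_eq, mem_univ_pi]
    simp only [mem_setOf_eq, hbPi, Pi.orthonormalBasis_repr]
    exact ⟨fun h i j => h ⟨i, j⟩, fun h s => h s.1 s.2⟩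
  rw [← bPi.addHaar_eq_volume, Basis.addHaar_eq_iff, Basis.coe_parallelepiped, OrthonormalBasis.coe_toBasis, Measure.map_apply hmeas hS, hset,
    Measure.pi_pi]
  simp only [OrthonormalBasis.volume_parallelepiped, Finset.prod_const_one]

end PiVolume

variable {N : ℕ} [NeZero N]

/-! ## §1 A Frobenius-isometric Euclidean frame of `𝔰𝔲(N)` -/

section SuFrame

omit [NeZero N] in
/-- `Re tr(XᴴX) > 0` for `X ≠ 0`. [folklore] -/
private theorem re_trace_conjTranspose_mul_self_pos' {X : Matrix (Fin N) (Fin N) ℂ} (hX : X ≠ 0) : 0 < ((Xᴴ * X).trace).re := by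
  rw [re_trace_conjTranspose_mul_self_eq_sum]
  obtain ⟨i, j, hij⟩ : ∃ i j, X i j ≠ 0 := by
    by_contra h
    push Not at h
    exact hX (Matrix.ext fun i j => h i j)
  have hij' : 0 < ‖X i j‖ ^ 2 := by positivity
  calc (0 : ℝ) < ‖X i j‖ ^ 2 := hij'
    _ ≤ ∑ j', ‖X i j'‖ ^ 2 := Finset.single_le_sum (f := fun j' => ‖X i j'‖ ^ 2) (fun j' _ => sq_nonneg _) (Finset.mem_univ j)
    _ ≤ ∑ i', ∑ j', ‖X i' j'‖ ^ 2 :=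
        Finset.single_le_sum (f := fun i' => ∑ j', ‖X i' j'‖ ^ 2) (fun i' _ => Finset.sum_nonneg fun _ _ => sq_nonneg _) (Finset.mem_univ i)

/-- ★ **A Frobenius-isometric Euclidean frame of `𝔰𝔲(N)`**: `ι₁ : ℝ^d ≃L 𝔰𝔲(N)` with `⟪u, u'⟫ = Re tr((ι₁ u)ᴴ (ι₁ u'))` (lit-4 L22 for the positive
definite symmetric real Frobenius pairing; `d = dim_ℝ 𝔰𝔲(N)`). [cite: HornJohnson2013, Cor. 7.2.8] -/
theorem exists_suFrame :
    ∃ ι₁ : EuclideanSpace ℝ (Fin (finrank ℝ (specialUnitaryLogChart (Fin N)).lie)) ≃L[ℝ] (specialUnitaryLogChart (Fin N)).lie,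
      ∀ u u', ⟪u, u'⟫_ℝ = ((((ι₁ u : (specialUnitaryLogChart (Fin N)).lie) : Matrix (Fin N) (Fin N) ℂ)ᴴ *
        ((ι₁ u' : (specialUnitaryLogChart (Fin N)).lie) : Matrix (Fin N) (Fin N) ℂ)).trace).re := by
  let bform : (specialUnitaryLogChart (Fin N)).lie →ₗ[ℝ] (specialUnitaryLogChart (Fin N)).lie →ₗ[ℝ] ℝ :=
    LinearMap.mk₂ ℝ (fun v w => ((((v : Matrix (Fin N) (Fin N) ℂ))ᴴ * (w : Matrix (Fin N) (Fin N) ℂ)).trace).re)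
      (fun v v' w => by
        simp only [Submodule.coe_add, Matrix.conjTranspose_add, Matrix.add_mul, Matrix.trace_add, Complex.add_re])
      (fun c v w => by
        simp only [Submodule.coe_smul, Matrix.conjTranspose_smul, Matrix.smul_mul, Matrix.trace_smul, star_trivial, Complex.smul_re, smul_eq_mul])
      (fun v w w' => by
        simp only [Submodule.coe_add, Matrix.mul_add, Matrix.trace_add, Complex.add_re])
      (fun c v w => by
        simp only [Submodule.coe_smul, Matrix.mul_smul, Matrix.trace_smul, Complex.smul_re, smul_eq_mul])
  have hsymm : ∀ v w : (specialUnitaryLogChart (Fin N)).lie, bform v w = bform w v := by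
    intro v w
    show ((((v : Matrix (Fin N) (Fin N) ℂ))ᴴ * (w : Matrix (Fin N) (Fin N) ℂ)).trace).re =
      ((((w : Matrix (Fin N) (Fin N) ℂ))ᴴ * (v : Matrix (Fin N) (Fin N) ℂ)).trace).re
    have h : (((w : Matrix (Fin N) (Fin N) ℂ))ᴴ * (v : Matrix (Fin N) (Fin N) ℂ))ᴴ = ((v : Matrix (Fin N) (Fin N) ℂ))ᴴ * (w : Matrix (Fin N) (Fin N) ℂ) := by
      rw [Matrix.conjTranspose_mul, Matrix.conjTranspose_conjTranspose]
    rw [← h, Matrix.trace_conjTranspose, Complex.star_def, Complex.conj_re]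
  have hpos : ∀ v : (specialUnitaryLogChart (Fin N)).lie, v ≠ 0 → 0 < bform v v := by
    intro v hv
    have hv' : (v : Matrix (Fin N) (Fin N) ℂ) ≠ 0 := fun h => hv (Subtype.ext h)
    exact re_trace_conjTranspose_mul_self_pos' hv'
  obtain ⟨e, he⟩ := exists_linearEquiv_euclideanSpace_inner_eq bform hsymm hpos
  refine ⟨e.symm.toContinuousLinearEquiv, fun u u' => ?_⟩
  have h := he (e.symm u) (e.symm u')
  rw [LinearEquiv.apply_symm_apply, LinearEquiv.apply_symm_apply] at h
  exact h

end SuFrame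

/-! ## §2 The product frame `piFrame : PiLp 2 (B → ℝ^d) ≃L 𝔤^B` and its push-forward measure -/

section PiFrame

variable (ι₁ : EuclideanSpace ℝ (Fin (finrank ℝ (specialUnitaryLogChart (Fin N)).lie)) ≃L[ℝ] (specialUnitaryLogChart (Fin N)).lie)
variable (B : Type*) [Fintype B]

/-- **The product frame** `piFrame ι₁ B : PiLp 2 (B → ℝ^d) ≃L 𝔤^B`, `w ↦ (b ↦ ι₁ (w b))` read in `𝔤^B` through `lieEquivPi⁻¹`.
[cite: Helgason2000, Ch. I §1 Thm 1.14 p. 96] [cite: Balaban1985UV3, (18) p. 260] -/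
def piFrame : PiLp 2 (fun _ : B => EuclideanSpace ℝ (Fin (finrank ℝ (specialUnitaryLogChart (Fin N)).lie))) ≃L[ℝ]
    (piLogChart (specialUnitaryLogChart (Fin N)) B).lie :=
  haveI : FiniteDimensional ℝ (piLogChart (specialUnitaryLogChart (Fin N)) B).lie := finiteDimensional_piLogChart_lie _ _
  ((PiLp.continuousLinearEquiv 2 ℝ (fun _ : B => EuclideanSpace ℝ (Fin (finrank ℝ (specialUnitaryLogChart (Fin N)).lie)))).trans
    (ContinuousLinearEquiv.piCongrRight fun _ : B => ι₁)).trans (lieEquivPi (specialUnitaryLogChart (Fin N)) B).symm.toContinuousLinearEquiv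

/-- Components of the product frame: `(piFrame w)(b) = ι₁ (w b)`. [folklore] -/
theorem coe_piFrame_apply (w : PiLp 2 (fun _ : B => EuclideanSpace ℝ (Fin (finrank ℝ (specialUnitaryLogChart (Fin N)).lie)))) (b : B) :
    ((piFrame ι₁ B w : (piLogChart (specialUnitaryLogChart (Fin N)) B).lie) : B → Matrix (Fin N) (Fin N) ℂ) b =
      ((ι₁ (w b) : (specialUnitaryLogChart (Fin N)).lie) : Matrix (Fin N) (Fin N) ℂ) := rfl

/-- `piFrame ∘ toLp = lieEquivPi⁻¹ ∘ (ι₁ componentwise)`. [folklore] -/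
theorem piFrame_comp_toLp :
    (⇑(piFrame ι₁ B) ∘ (toLp 2 : (B → EuclideanSpace ℝ (Fin (finrank ℝ (specialUnitaryLogChart (Fin N)).lie))) → _)) =
      (fun X : B → (specialUnitaryLogChart (Fin N)).lie => (lieEquivPi (specialUnitaryLogChart (Fin N)) B).symm X) ∘
        fun f b => ι₁ (f b) := rfl

/-- ★ **The product frame is Frobenius-isometric** when `ι₁` is: `⟪w, w'⟫ = Σ_b Re tr((piFrame w)(b)ᴴ (piFrame w')(b))`.
[cite: Helgason2000, Ch. I §1 Thm 1.14 p. 96] -/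
theorem inner_eq_ePairing_piFrame
    (hι₁ : ∀ u u', ⟪u, u'⟫_ℝ = ((((ι₁ u : (specialUnitaryLogChart (Fin N)).lie) : Matrix (Fin N) (Fin N) ℂ)ᴴ *
      ((ι₁ u' : (specialUnitaryLogChart (Fin N)).lie) : Matrix (Fin N) (Fin N) ℂ)).trace).re)
    (w w' : PiLp 2 (fun _ : B => EuclideanSpace ℝ (Fin (finrank ℝ (specialUnitaryLogChart (Fin N)).lie)))) :
    ⟪w, w'⟫_ℝ = ePairing ((piFrame ι₁ B w : (piLogChart (specialUnitaryLogChart (Fin N)) B).lie) : B → Matrix (Fin N) (Fin N) ℂ)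
      ((piFrame ι₁ B w' : (piLogChart (specialUnitaryLogChart (Fin N)) B).lie) : B → Matrix (Fin N) (Fin N) ℂ) := by
  rw [PiLp.inner_apply]
  unfold ePairing
  exact Finset.sum_congr rfl fun b _ => hι₁ _ _

/-- ★★ **THE PUSH-FORWARD OF LEBESGUE MEASURE UNDER THE PRODUCT FRAME IS L26's PRODUCT REFERENCE MEASURE**:
`vol ∘ (piFrame ι₁ B)⁻¹ = (⊗_B (vol ∘ ι₁⁻¹)) ∘ lieEquivPi` (§0 + Mathlib `measurePreserving_pi`). [cite: Balaban1985UV3, (18) p. 260]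
[cite: Helgason2000, Ch. I §1 Thm 1.14 (13) p. 96] -/
theorem volume_map_piFrame :
    letI : MeasurableSpace (piLogChart (specialUnitaryLogChart (Fin N)) B).lie := borel _
    letI : MeasurableSpace (specialUnitaryLogChart (Fin N)).lie := borel _
    (volume : Measure (PiLp 2 (fun _ : B => EuclideanSpace ℝ (Fin (finrank ℝ (specialUnitaryLogChart (Fin N)).lie))))).map (piFrame ι₁ B) =
      (Measure.pi fun _ : B => (volume : Measure (EuclideanSpace ℝ (Fin (finrank ℝ (specialUnitaryLogChart (Fin N)).lie)))).map ι₁).map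
        fun X : B → (specialUnitaryLogChart (Fin N)).lie => (lieEquivPi (specialUnitaryLogChart (Fin N)) B).symm X := by
  classical
  letI : MeasurableSpace (piLogChart (specialUnitaryLogChart (Fin N)) B).lie := borel _
  haveI : BorelSpace (piLogChart (specialUnitaryLogChart (Fin N)) B).lie := ⟨rfl⟩
  letI : MeasurableSpace (specialUnitaryLogChart (Fin N)).lie := borel _
  haveI : BorelSpace (specialUnitaryLogChart (Fin N)).lie := ⟨rfl⟩
  haveI : FiniteDimensional ℝ (piLogChart (specialUnitaryLogChart (Fin N)) B).lie := finiteDimensional_piLogChart_lie _ _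
  haveI : ((volume : Measure (EuclideanSpace ℝ (Fin (finrank ℝ (specialUnitaryLogChart (Fin N)).lie)))).map ι₁).IsAddHaarMeasure :=
    ι₁.isAddHaarMeasure_map _
  have hmeas_toLp : Measurable (toLp 2 : (B → EuclideanSpace ℝ (Fin (finrank ℝ (specialUnitaryLogChart (Fin N)).lie))) →
      PiLp 2 (fun _ : B => EuclideanSpace ℝ (Fin (finrank ℝ (specialUnitaryLogChart (Fin N)).lie)))) :=
    (PiLp.continuousLinearEquiv 2 ℝ (fun _ : B => EuclideanSpace ℝ (Fin (finrank ℝ (specialUnitaryLogChart (Fin N)).lie)))).symm.continuous.measurable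
  have hmeas_symm : Measurable fun X : B → (specialUnitaryLogChart (Fin N)).lie => (lieEquivPi (specialUnitaryLogChart (Fin N)) B).symm X :=
    (lieEquivPi (specialUnitaryLogChart (Fin N)) B).symm.toLinearMap.continuous_of_finiteDimensional.measurable
  have hmeas_pi : Measurable fun (f : B → EuclideanSpace ℝ (Fin (finrank ℝ (specialUnitaryLogChart (Fin N)).lie))) (b : B) => ι₁ (f b) :=
    measurable_pi_iff.2 fun b => ι₁.continuous.measurable.comp (measurable_pi_apply b)
  rw [volume_eq_map_toLp_pi, Measure.map_map (piFrame ι₁ B).continuous.measurable hmeas_toLp, piFrame_comp_toLp,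
    ← Measure.map_map hmeas_symm hmeas_pi]
  congr 1
  exact (measurePreserving_pi (fun _ : B => (volume : Measure (EuclideanSpace ℝ (Fin (finrank ℝ (specialUnitaryLogChart (Fin N)).lie)))))
    (fun _ : B => (volume : Measure (EuclideanSpace ℝ (Fin (finrank ℝ (specialUnitaryLogChart (Fin N)).lie)))).map ι₁)
    (fun _ => ⟨ι₁.continuous.measurable, rfl⟩)).map_eq

end PiFrame

/-! ## §3 The one-site window constant `σ₁` and `σ₀(SU(N)^B) = σ₁^{|B|}`; the site frame -/

section Sigma

/-- **B89's one-site window constant** `σ₁(η) = μ₁(V_s) ∕ ν_s(η)(V_s)` of `SU(N)` (Haar probability `μ₁`, exponential chart at its chart radius `s`,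
reference measure `η` on `𝔰𝔲(N)` with the Borel σ-algebra) — as a real number. [cite: Helgason2000, Ch. I §1 Thm 1.14 (13) p. 96] [cite: Balaban1985UV3, p. 260] -/
def suSiteWindowConst (η : @Measure (specialUnitaryLogChart (Fin N)).lie (borel _)) : ℝ :=
  letI : MeasurableSpace (specialUnitaryLogChart (Fin N)).lie := borel _
  (haarProbability (Matrix.specialUnitaryGroup (Fin N) ℂ)
        ((isChartRep_specialUnitaryGroup (n := Fin N)).window (IsChartRep.chartRadius (specialUnitaryLogChart (Fin N)))) /
      (isChartRep_specialUnitaryGroup (n := Fin N)).chartMeasure (lie_adStable_specialUnitaryGroup (n := Fin N)) η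
        (IsChartRep.chartRadius (specialUnitaryLogChart (Fin N)))
        ((isChartRep_specialUnitaryGroup (n := Fin N)).window (IsChartRep.chartRadius (specialUnitaryLogChart (Fin N))))).toReal

variable (ι₁ : EuclideanSpace ℝ (Fin (finrank ℝ (specialUnitaryLogChart (Fin N)).lie)) ≃L[ℝ] (specialUnitaryLogChart (Fin N)).lie)

/-- `σ₁(vol ∘ ι₁⁻¹) > 0` (the frame's Lebesgue measure is an additive Haar measure on `𝔰𝔲(N)`). [cite: Helgason2000, Ch. I §1 Thm 1.14 (13) p. 96] -/
theorem suSiteWindowConst_map_pos :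
    letI : MeasurableSpace (specialUnitaryLogChart (Fin N)).lie := borel _
    0 < suSiteWindowConst ((volume : Measure (EuclideanSpace ℝ (Fin (finrank ℝ (specialUnitaryLogChart (Fin N)).lie)))).map ι₁) := by
  letI : MeasurableSpace (specialUnitaryLogChart (Fin N)).lie := borel _
  haveI : BorelSpace (specialUnitaryLogChart (Fin N)).lie := ⟨rfl⟩
  haveI : ((volume : Measure (EuclideanSpace ℝ (Fin (finrank ℝ (specialUnitaryLogChart (Fin N)).lie)))).map ι₁).IsAddHaarMeasure :=
    ι₁.isAddHaarMeasure_map _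
  have hc := (isChartRep_specialUnitaryGroup (n := Fin N)).windowConst_ne_zero_and_ne_top (lie_adStable_specialUnitaryGroup (n := Fin N))
    ((volume : Measure (EuclideanSpace ℝ (Fin (finrank ℝ (specialUnitaryLogChart (Fin N)).lie)))).map ι₁)
    (haarProbability (Matrix.specialUnitaryGroup (Fin N) ℂ)) (IsChartRep.chartRadius_pos (C := specialUnitaryLogChart (Fin N))) le_rfl
  exact ENNReal.toReal_pos hc.1 hc.2

/-- ★★ **`σ₀(SU(N)^B; vol ∘ piFrame⁻¹; ⊗ Haar prob) = σ₁^{|B|}`** (lit-4 L26 `windowConst_pi_toReal` at the product reference measure of §2).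
[cite: Balaban1985UV3, (18) p. 260 (`σ₀^{|Ω₁|}`)] [cite: Helgason2000, Ch. I §1 Thm 1.14 (13) p. 96] -/
theorem suPiWindowConst_piFrame (B : Type*) [Fintype B] :
    letI : MeasurableSpace (piLogChart (specialUnitaryLogChart (Fin N)) B).lie := borel _
    letI : MeasurableSpace (specialUnitaryLogChart (Fin N)).lie := borel _
    suPiWindowConst B ((volume : Measure (PiLp 2 (fun _ : B => EuclideanSpace ℝ (Fin (finrank ℝ (specialUnitaryLogChart (Fin N)).lie))))).map (piFrame ι₁ B))
        (Measure.pi fun _ : B => haarProbability (Matrix.specialUnitaryGroup (Fin N) ℂ)) =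
      suSiteWindowConst ((volume : Measure (EuclideanSpace ℝ (Fin (finrank ℝ (specialUnitaryLogChart (Fin N)).lie)))).map ι₁) ^ Fintype.card B := by
  letI : MeasurableSpace (piLogChart (specialUnitaryLogChart (Fin N)) B).lie := borel _
  haveI : BorelSpace (piLogChart (specialUnitaryLogChart (Fin N)) B).lie := ⟨rfl⟩
  letI : MeasurableSpace (specialUnitaryLogChart (Fin N)).lie := borel _
  haveI : BorelSpace (specialUnitaryLogChart (Fin N)).lie := ⟨rfl⟩
  haveI : FiniteDimensional ℝ (piLogChart (specialUnitaryLogChart (Fin N)) B).lie := finiteDimensional_piLogChart_lie _ _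
  haveI : ((volume : Measure (EuclideanSpace ℝ (Fin (finrank ℝ (specialUnitaryLogChart (Fin N)).lie)))).map ι₁).IsAddHaarMeasure :=
    ι₁.isAddHaarMeasure_map _
  have h := windowConst_pi_toReal (isChartRep_specialUnitaryGroup (n := Fin N)) (lie_adStable_specialUnitaryGroup (n := Fin N))
    ((volume : Measure (EuclideanSpace ℝ (Fin (finrank ℝ (specialUnitaryLogChart (Fin N)).lie)))).map ι₁)
    (haarProbability (Matrix.specialUnitaryGroup (Fin N) ℂ)) B
  unfold suPiWindowConst suSiteWindowConst
  rw [volume_map_piFrame]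
  exact h

variable (n₀ n₁ n₂ n₃ : ℕ)

/-- **The site frame** `sitesFrame ι₁ : PiLp 2 (sites → ℝ^d) ≃L suFields` (`= suFieldsLie⁻¹ ∘ piFrame`). [folklore] -/
def sitesFrame : PiLp 2 (fun _ : FinTorusSite n₀ n₁ n₂ n₃ => EuclideanSpace ℝ (Fin (finrank ℝ (specialUnitaryLogChart (Fin N)).lie))) ≃L[ℝ]
    suFields N n₀ n₁ n₂ n₃ :=
  (piFrame ι₁ (FinTorusSite n₀ n₁ n₂ n₃)).trans suFieldsLie.symm

/-- `suFieldsLie ∘ sitesFrame = piFrame`. [folklore] -/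
theorem suFieldsLie_sitesFrame (w : PiLp 2 (fun _ : FinTorusSite n₀ n₁ n₂ n₃ => EuclideanSpace ℝ (Fin (finrank ℝ (specialUnitaryLogChart (Fin N)).lie)))) :
    suFieldsLie (sitesFrame ι₁ n₀ n₁ n₂ n₃ w) = piFrame ι₁ (FinTorusSite n₀ n₁ n₂ n₃) w := by
  rw [sitesFrame, ContinuousLinearEquiv.trans_apply, ContinuousLinearEquiv.apply_symm_apply]

/-- ★ **The site frame is Frobenius-isometric** when `ι₁` is: `⟪w, w'⟫ = sPairing (sitesFrame w) (sitesFrame w')`. [folklore] -/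
theorem inner_eq_sPairing_sitesFrame
    (hι₁ : ∀ u u', ⟪u, u'⟫_ℝ = ((((ι₁ u : (specialUnitaryLogChart (Fin N)).lie) : Matrix (Fin N) (Fin N) ℂ)ᴴ *
      ((ι₁ u' : (specialUnitaryLogChart (Fin N)).lie) : Matrix (Fin N) (Fin N) ℂ)).trace).re)
    (w w' : PiLp 2 (fun _ : FinTorusSite n₀ n₁ n₂ n₃ => EuclideanSpace ℝ (Fin (finrank ℝ (specialUnitaryLogChart (Fin N)).lie)))) :
    ⟪w, w'⟫_ℝ = sPairing ((sitesFrame ι₁ n₀ n₁ n₂ n₃ w : suFields N n₀ n₁ n₂ n₃) : FinTorusSite n₀ n₁ n₂ n₃ → Matrix (Fin N) (Fin N) ℂ)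
      ((sitesFrame ι₁ n₀ n₁ n₂ n₃ w' : suFields N n₀ n₁ n₂ n₃) : FinTorusSite n₀ n₁ n₂ n₃ → Matrix (Fin N) (Fin N) ℂ) :=
  inner_eq_ePairing_piFrame ι₁ (FinTorusSite n₀ n₁ n₂ n₃) hι₁ w w'

end Sigma

end Summit.QuantumFields.YangMills.Cruxes.IRcof.TwistedSlab

end
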